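import Literature.MathematicalPhysics.QuantumFieldTheory.Balaban1983to89.T3UnitScaleTilt
import Literature.MathematicalPhysics.QuantumFieldTheory.Balaban1983to89.T3UnitLawDensityEML

/-!
# Route `RandomisedStokes` (LINE 18, crux stmt-QuantumFields-19936): glue `HistoryTailOfChaosL` (stmt-QuantumFields-23887) — engine, part 2:
# THE OFF-SLIVER ARITHMETIC

At distance `h = K − j` from the unit scale write `g = √(γL^{−h})`, `u = 1 + log g⁻¹ = 1 + (h log L − log γ)/2`, `p = p(g) = b₀u^{p₀}`,
`J = j + 1`.  OFF the sliver (`J^N ≤ p`) the single parameter `P = max u J ≥ 1` controls every loss (`h log L ≤ 2P`, `log γ⁻¹ ≤ 2P`,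
`j log L ≤ P log L`, `J ≤ P`, hence `β_K ≤ e^{(4+log L)P}`, `2^h ≤ e^{2P}`) while `P^N ≤ p` (`b₀ ≥ 1`, `N ≤ p₀`) drives the gains:
the rectangle exponent `c_R θ²β_K/(4D²J²·RL^j(1+log(RL^j))) = c_R p²/(4D²J²R(1+log R+j log L)) ≥ (c_R/c₁)·P^{2N−3}` and the chaos exponent
`c_X θ/(2DJ·γL^{−h}) = c_X p/(2DJg) ≥ (c_X/2D)·P^{N−1}`; with `(2N−3)α_R > 1`, `(N−1)α_X > 1` the function `kP − κP^e` is bounded, so both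
off-sliver terms of the per-plaquette bound, multiplied by the plaquette count `9·8L^{3m}(L^h)³`, are `≤ A·2^{−h}` uniformly in `(K, j)`.

Pure real analysis; nothing about the Gibbs measure.  No crux, rung or summit is proved; the Yang–Mills mass gap is NOT proved by any of this.
Cell `ym-idea-1`, LEAD seat `ym-line-sfw-p2` g71 (free hands), `--supports stmt-QuantumFields-23887`.
References: T. Bałaban, CMP 102 (1985) 255–275 [Balaban1985UV3] ((3) p.256, (7) p.257: `g_k`, `p(g) = b₀(1+log g⁻¹)^{p₀}`).
-/

set_option autoImplicit false

noncomputable section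

open MeasureTheory Filter Topology
open Literature.MathematicalPhysics.QuantumFieldTheory.Balaban1983to89
open Literature.MathematicalPhysics.QuantumFieldTheory.Balaban1983to89.T3ContinuumYM3Torus
open Literature.MathematicalPhysics.QuantumFieldTheory.Balaban1983to89.T3UnitScaleTilt
open Literature.MathematicalPhysics.QuantumFieldTheory.Balaban1983to89.T3UnitLawDensityEML (ℰp)

namespace Summit.QuantumFields.YangMills.Theorems.RandomisedStokesOffSliverArith

/-! ## §1 `kP − κP^e` is bounded for `e > 1` -/

/-- For `k ≥ 0`, `κ > 0`, `e > 1` and `P ≥ 1`: `kP − κP^e ≤ k · max 1 (k/κ)^{1/(e−1)}`. [folklore] -/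
theorem linear_sub_rpow_le {k κ e P : ℝ} (hk : 0 ≤ k) (hκ : 0 < κ) (he : 1 < e) (hP : 1 ≤ P) :
    k * P - κ * P ^ e ≤ k * max 1 ((k / κ) ^ (1 / (e - 1))) := by
  set P₀ : ℝ := max 1 ((k / κ) ^ (1 / (e - 1))) with hP₀
  have hP0 : 0 < P := one_pos.trans_le hP
  have hPe0 : 0 ≤ κ * P ^ e := mul_nonneg hκ.le (Real.rpow_nonneg hP0.le e)
  by_cases hc : P ≤ P₀
  · calc k * P - κ * P ^ e ≤ k * P := by linarith
      _ ≤ k * P₀ := mul_le_mul_of_nonneg_left hc hk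
  · rw [not_le] at hc
    have he1 : 0 < e - 1 := by linarith
    have hkκ : 0 ≤ k / κ := div_nonneg hk hκ.le
    -- `P^{e-1} ≥ P₀^{e-1} ≥ k/κ`
    have h1 : (k / κ) ^ (1 / (e - 1)) ≤ P := (le_max_right _ _).trans hc.le
    have h2 : k / κ ≤ P ^ (e - 1) := by
      have := Real.rpow_le_rpow (Real.rpow_nonneg hkκ _) h1 he1.le
      rwa [← Real.rpow_mul hkκ, one_div_mul_cancel he1.ne', Real.rpow_one] at this
    have h3 : k * P ≤ κ * P ^ e := by
      have h4 : P ^ e = P ^ (e - 1) * P := by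
        rw [← Real.rpow_add_one hP0.ne' (e - 1)]; ring_nf
      rw [h4]
      have : k ≤ κ * P ^ (e - 1) := by rwa [div_le_iff₀' hκ] at h2
      nlinarith
    calc k * P - κ * P ^ e ≤ 0 := by linarith
      _ ≤ k * P₀ := mul_nonneg hk (zero_le_one.trans (le_max_left _ _))

/-! ## §2 The off-sliver control parameter `P = max u (j+1)` -/

/-- **OFF-SLIVER FACTS** (`0 < γ ≤ 1`, `1 ≤ b₀`, `N ≤ p₀`, `j ≤ K`, `(j+1)^N ≤ p(g_{K−j})`): with `g = √(γL^{−(K−j)})` there is `P ≥ 1` with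
`j + 1 ≤ P`, `P^N ≤ p(g)`, `(K−j)·log L ≤ 2P`, `−log γ ≤ 2P`; moreover `0 < g ≤ 1`, `p(g) = b₀(1+log g⁻¹)^{p₀} ≥ 1`,
`θ(K−j) = g·p(g)`, `β_K = γ⁻¹L^{K−j}L^j` and `θ(K−j)²β_K = p(g)²L^j`. [cite: Balaban1985UV3, (3) p.256 and (7) p.257] -/
theorem offSliver_facts (F : T3Family) {γ b₀ p₀ : ℝ} (hγ : 0 < γ) (hγ1 : γ ≤ 1) (hb₀ : 1 ≤ b₀) {N : ℕ} (hNp₀ : (N : ℝ) ≤ p₀)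
    (K j : ℕ) (hjK : j ≤ K)
    (hoff : ((j : ℝ) + 1) ^ N ≤ B10.pFun b₀ p₀ (Real.sqrt (γ * ((F.L : ℝ)⁻¹) ^ (K - j)))) :
    ∃ P : ℝ, 1 ≤ P ∧ (j : ℝ) + 1 ≤ P ∧ P ^ N ≤ B10.pFun b₀ p₀ (Real.sqrt (γ * ((F.L : ℝ)⁻¹) ^ (K - j))) ∧
      ((K - j : ℕ) : ℝ) * Real.log F.L ≤ 2 * P ∧ -Real.log γ ≤ 2 * P ∧
      0 < Real.sqrt (γ * ((F.L : ℝ)⁻¹) ^ (K - j)) ∧ Real.sqrt (γ * ((F.L : ℝ)⁻¹) ^ (K - j)) ≤ 1 ∧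
      1 ≤ B10.pFun b₀ p₀ (Real.sqrt (γ * ((F.L : ℝ)⁻¹) ^ (K - j))) ∧
      θBal F.L γ b₀ p₀ (K - j) = Real.sqrt (γ * ((F.L : ℝ)⁻¹) ^ (K - j)) * B10.pFun b₀ p₀ (Real.sqrt (γ * ((F.L : ℝ)⁻¹) ^ (K - j))) ∧
      (F.scheme ℰp γ).β K = γ⁻¹ * (F.L : ℝ) ^ (K - j) * (F.L : ℝ) ^ j ∧
      θBal F.L γ b₀ p₀ (K - j) ^ 2 * (F.scheme ℰp γ).β K =
        B10.pFun b₀ p₀ (Real.sqrt (γ * ((F.L : ℝ)⁻¹) ^ (K - j))) ^ 2 * (F.L : ℝ) ^ j := by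
  -- constants and the coupling at distance `h`
  have hL1 : (1 : ℝ) < F.L := by exact_mod_cast F.hL.2
  have hL0 : (0 : ℝ) < F.L := one_pos.trans hL1
  set h : ℕ := K - j with hh
  have hK : K = h + j := by omega
  set ℓ : ℝ := Real.log F.L with hℓ
  have hℓ0 : 0 < ℓ := Real.log_pos hL1
  have hlogγ : Real.log γ ≤ 0 := Real.log_nonpos hγ.le hγ1
  set x : ℝ := γ * ((F.L : ℝ)⁻¹) ^ h with hx
  have hLh0 : (0 : ℝ) < (F.L : ℝ) ^ h := pow_pos hL0 h
  have hinvh : ((F.L : ℝ)⁻¹) ^ h = ((F.L : ℝ) ^ h)⁻¹ := by rw [inv_pow]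
  have hx0 : 0 < x := by rw [hx, hinvh]; positivity
  have hx1 : x ≤ 1 := by
    rw [hx, hinvh]
    calc γ * ((F.L : ℝ) ^ h)⁻¹ ≤ 1 * 1 :=
          mul_le_mul hγ1 (inv_le_one_of_one_le₀ (one_le_pow₀ hL1.le)) (by positivity) zero_le_one
      _ = 1 := one_mul 1
  set g : ℝ := Real.sqrt x with hg
  have hg0 : 0 < g := Real.sqrt_pos.mpr hx0
  have hg1 : g ≤ 1 := Real.sqrt_le_one.mpr hx1
  have hlogg : Real.log g⁻¹ = (h * ℓ - Real.log γ) / 2 := by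
    rw [Real.log_inv, hg, Real.log_sqrt hx0.le, hx, Real.log_mul hγ.ne' (pow_ne_zero _ (inv_ne_zero hL0.ne')),
      Real.log_pow, Real.log_inv]
    ring
  set u : ℝ := 1 + Real.log g⁻¹ with hu
  have hu1 : 1 ≤ u := by
    rw [hu, hlogg]; have : 0 ≤ (h : ℝ) * ℓ := by positivity
    linarith
  have hu0 : 0 ≤ u := zero_le_one.trans hu1
  have hpF : B10.pFun b₀ p₀ g = b₀ * u ^ p₀ := rfl
  have hN0p₀ : (0 : ℝ) ≤ p₀ := (Nat.cast_nonneg N).trans hNp₀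
  have hup1 : 1 ≤ u ^ p₀ := Real.one_le_rpow hu1 hN0p₀
  have hp1 : 1 ≤ B10.pFun b₀ p₀ g := by
    rw [hpF]; calc (1 : ℝ) = 1 * 1 := (one_mul 1).symm
      _ ≤ b₀ * u ^ p₀ := mul_le_mul hb₀ hup1 zero_le_one (zero_le_one.trans hb₀)
  -- `u^N ≤ p`
  have huN : u ^ N ≤ B10.pFun b₀ p₀ g := by
    rw [hpF]
    calc u ^ N = u ^ (N : ℝ) := (Real.rpow_natCast u N).symm
      _ ≤ u ^ p₀ := Real.rpow_le_rpow_of_exponent_le hu1 hNp₀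
      _ = 1 * u ^ p₀ := (one_mul _).symm
      _ ≤ b₀ * u ^ p₀ := mul_le_mul_of_nonneg_right hb₀ (zero_le_one.trans hup1)
  -- the parameter
  set P : ℝ := max u ((j : ℝ) + 1) with hP
  have hPN : P ^ N ≤ B10.pFun b₀ p₀ g := by
    rcases le_total u ((j : ℝ) + 1) with hle | hle
    · rw [hP, max_eq_right hle]; exact hoff
    · rw [hP, max_eq_left hle]; exact huN
  refine ⟨P, hu1.trans (le_max_left _ _), le_max_right _ _, hPN, ?_, ?_, hg0, hg1, hp1, rfl, ?_, ?_⟩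
  · -- `h ℓ ≤ 2P`
    have : (h : ℝ) * ℓ ≤ 2 * u := by rw [hu, hlogg]; linarith
    exact this.trans (by linarith [le_max_left u ((j : ℝ) + 1)])
  · -- `−log γ ≤ 2P`
    have : -Real.log γ ≤ 2 * u := by
      rw [hu, hlogg]; have : 0 ≤ (h : ℝ) * ℓ := by positivity
      linarith
    exact this.trans (by linarith [le_max_left u ((j : ℝ) + 1)])
  · -- `β_K = γ⁻¹ L^h L^j`
    show (γ * ((F.L : ℝ)⁻¹) ^ K)⁻¹ = γ⁻¹ * (F.L : ℝ) ^ h * (F.L : ℝ) ^ j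
    rw [mul_inv, inv_pow, inv_inv, hK, pow_add]; ring
  · -- `θ² β_K = p² L^j`
    show (Real.sqrt x * B10.pFun b₀ p₀ (Real.sqrt x)) ^ 2 * (γ * ((F.L : ℝ)⁻¹) ^ K)⁻¹ = B10.pFun b₀ p₀ (Real.sqrt x) ^ 2 * (F.L : ℝ) ^ j
    have hsq : Real.sqrt x ^ 2 = x := Real.sq_sqrt hx0.le
    have hxβ : x * (γ * ((F.L : ℝ)⁻¹) ^ K)⁻¹ = (F.L : ℝ) ^ j := by
      rw [hx, hK, pow_add, inv_pow, inv_pow]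
      field_simp
    calc (Real.sqrt x * B10.pFun b₀ p₀ (Real.sqrt x)) ^ 2 * (γ * ((F.L : ℝ)⁻¹) ^ K)⁻¹
        = B10.pFun b₀ p₀ (Real.sqrt x) ^ 2 * (x * (γ * ((F.L : ℝ)⁻¹) ^ K)⁻¹) := by rw [mul_pow, hsq]; ring
      _ = B10.pFun b₀ p₀ (Real.sqrt x) ^ 2 * (F.L : ℝ) ^ j := by rw [hxβ]


/-! ## §3 Elementary exponential bookkeeping -/

/-- `0 ≤ a ≤ exp s`, `0 ≤ b ≤ exp t` ⇒ `a·b ≤ exp (s+t)`. [folklore] -/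
theorem mul_le_exp_add {a b s t : ℝ} (hab : a ≤ Real.exp s) (hb0 : 0 ≤ b) (hb : b ≤ Real.exp t) :
    a * b ≤ Real.exp (s + t) := by
  rw [Real.exp_add]; exact mul_le_mul hab hb hb0 (Real.exp_nonneg _)

/-! ## §4 The rectangle (union) term off the sliver -/

/-- **THE RECTANGLE TERM OFF THE SLIVER** (`0 < γ ≤ 1`, `b₀ ≥ 1`, `N ≤ p₀`, `N ≥ 3`, `(2N−3)α_R > 1`, `D ≥ 1`, `R ≥ 2`, `c_R > 0`,
`C_R ≥ 0`): there is `A ≥ 0` such that for all `j ≤ K` with `(j+1)^N ≤ p(g_{K−j})` the plaquette count times the rectangle-union term of the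
per-plaquette bound is `≤ A·2^{−(K−j)}`. [cite: Balaban1985UV3, (7) p.257] -/
theorem offSliver_R_term (F : T3Family) {γ b₀ p₀ : ℝ} (hγ : 0 < γ) (hγ1 : γ ≤ 1) (hb₀ : 1 ≤ b₀) {N : ℕ} (hNp₀ : (N : ℝ) ≤ p₀)
    (hN3 : 3 ≤ N) {D R αR cR CR : ℝ} {AR : ℕ} (hD : 1 ≤ D) (hR : 2 ≤ R) (hαR : 0 < αR) (hcR : 0 < cR) (hCR : 0 ≤ CR)
    (heR : 1 < ((2 * N - 3 : ℕ) : ℝ) * αR) :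
    ∃ A : ℝ, 0 ≤ A ∧ ∀ K j : ℕ, j ≤ K → ((j : ℝ) + 1) ^ N ≤ B10.pFun b₀ p₀ (Real.sqrt (γ * ((F.L : ℝ)⁻¹) ^ (K - j))) →
      (9 * (8 * (F.L : ℝ) ^ (3 * F.m) * ((F.L : ℝ) ^ (K - j)) ^ 3)) *
        ((((j : ℝ) + 1) * ((⌊R * (F.L : ℝ) ^ j⌋₊ : ℝ) + 1) ^ 2 * (((F.P K).sitesPerDir 0 : ℝ)) ^ 3 * 9) *
          (CR * (F.scheme ℰp γ).β K ^ AR * (R * (F.L : ℝ) ^ j) ^ AR *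
            Real.exp (-((cR * ((θBal F.L γ b₀ p₀ (K - j) / (2 * D * ((j : ℝ) + 1))) ^ 2 * (F.scheme ℰp γ).β K /
              (R * (F.L : ℝ) ^ j * (1 + Real.log (R * (F.L : ℝ) ^ j))))) ^ αR)))) ≤
      A * ((1 : ℝ) / 2) ^ (K - j) := by
  -- constants of the family
  have hLn : 2 ≤ F.L := F.hL.2
  have hL2 : (2 : ℝ) ≤ F.L := by exact_mod_cast hLn
  have hL1 : (1 : ℝ) < F.L := by linarith
  have hL0 : (0 : ℝ) < F.L := by linarith
  have hpowexp : ∀ n : ℕ, (F.L : ℝ) ^ n = Real.exp ((n : ℝ) * Real.log F.L) := fun n => by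
    rw [Real.exp_nat_mul, Real.exp_log hL0]
  set ℓ : ℝ := Real.log F.L with hℓ
  have hℓ0 : 0 < ℓ := Real.log_pos hL1
  have hℓ2 : Real.log 2 ≤ ℓ := Real.log_le_log two_pos hL2
  have hlogR : 0 ≤ Real.log R := Real.log_nonneg (by linarith)
  have hR0 : 0 < R := by linarith
  have hD0 : 0 < D := by linarith
  set c₁ : ℝ := 4 * D ^ 2 * R * (1 + Real.log R + ℓ) with hc₁
  have hc₁0 : 0 < c₁ := by positivity
  set κ : ℝ := (cR / c₁) ^ αR with hκ
  have hκ0 : 0 < κ := Real.rpow_pos_of_pos (div_pos hcR hc₁0) αR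
  set e : ℝ := ((2 * N - 3 : ℕ) : ℝ) * αR with he
  set k : ℝ := 15 + 5 * ℓ + (AR : ℝ) * (4 + 2 * ℓ) with hk
  have hk0 : 0 ≤ k := by positivity
  set M : ℝ := k * max 1 ((k / κ) ^ (1 / (e - 1))) with hM
  set Kc : ℝ := Real.log (72 * (F.L : ℝ) ^ (3 * F.m)) + Real.log (288 * R ^ 2 * (F.L : ℝ) ^ (3 * F.m)) +
    (Real.log (CR + 1) + (AR : ℝ) * Real.log R) with hKc
  refine ⟨Real.exp (Kc + M), (Real.exp_pos _).le, fun K j hjK hoff => ?_⟩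
  obtain ⟨P, hP1, hJP, hPN, hhℓ, hlγ, hg0, hg1, hp1, hθ, hβ, hθβ⟩ := offSliver_facts F hγ hγ1 hb₀ hNp₀ K j hjK hoff
  -- abbreviations
  set h : ℕ := K - j with hh
  set g : ℝ := Real.sqrt (γ * ((F.L : ℝ)⁻¹) ^ h) with hg
  set p : ℝ := B10.pFun b₀ p₀ g with hp
  set θ : ℝ := θBal F.L γ b₀ p₀ h with hθ_def
  set β : ℝ := (F.scheme ℰp γ).β K with hβ_def
  set J : ℝ := (j : ℝ) + 1 with hJ
  set Lj : ℝ := (F.L : ℝ) ^ j with hLj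
  have hP0 : 0 < P := one_pos.trans_le hP1
  have hJ1 : 1 ≤ J := by rw [hJ]; have : (0:ℝ) ≤ j := Nat.cast_nonneg j; linarith
  have hjP : (j : ℝ) ≤ P := by linarith
  have hLj1 : 1 ≤ Lj := one_le_pow₀ hL1.le
  have hLj0 : 0 < Lj := by linarith
  have hLh : (F.L : ℝ) ^ h = Real.exp ((h : ℝ) * ℓ) := hpowexp h
  have hLjexp : Lj = Real.exp ((j : ℝ) * ℓ) := hpowexp j
  have hγinv : γ⁻¹ = Real.exp (-Real.log γ) := by rw [Real.exp_neg, Real.exp_log hγ]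
  have hp0 : 0 < p := one_pos.trans_le hp1
  have hβ1 : β = γ⁻¹ * (F.L : ℝ) ^ h * Lj := hβ
  have hβpos : 0 < β := by rw [hβ1]; positivity
  -- elementary exponential bounds in `P`
  have eLh : (F.L : ℝ) ^ h ≤ Real.exp (2 * P) := by rw [hLh]; exact Real.exp_le_exp.mpr hhℓ
  have hjℓ : (j : ℝ) * ℓ ≤ ℓ * P := by rw [mul_comm]; exact mul_le_mul_of_nonneg_left hjP hℓ0.le
  have eLj : Lj ≤ Real.exp (ℓ * P) := by
    rw [hLjexp]; exact Real.exp_le_exp.mpr hjℓ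
  have eγ : γ⁻¹ ≤ Real.exp (2 * P) := by rw [hγinv]; exact Real.exp_le_exp.mpr hlγ
  have eβ : β ≤ Real.exp ((4 + ℓ) * P) := by
    rw [hβ1, show (4 + ℓ) * P = (2 * P + 2 * P) + ℓ * P by ring]
    exact mul_le_exp_add (mul_le_exp_add eγ (by positivity) eLh) hLj0.le eLj
  have eJ : J ≤ Real.exp P := hJP.trans (by linarith [Real.add_one_le_exp P])
  -- (b1) the plaquette count
  have b1 : 9 * (8 * (F.L : ℝ) ^ (3 * F.m) * ((F.L : ℝ) ^ h) ^ 3) ≤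
      Real.exp (Real.log (72 * (F.L : ℝ) ^ (3 * F.m)) + 6 * P) := by
    have h3 : ((F.L : ℝ) ^ h) ^ 3 ≤ Real.exp (6 * P) := by
      calc ((F.L : ℝ) ^ h) ^ 3 ≤ (Real.exp (2 * P)) ^ 3 := pow_le_pow_left₀ (by positivity) eLh 3
        _ = Real.exp (6 * P) := by rw [← Real.exp_nat_mul]; ring_nf
    rw [Real.exp_add, Real.exp_log (by positivity)]
    calc 9 * (8 * (F.L : ℝ) ^ (3 * F.m) * ((F.L : ℝ) ^ h) ^ 3) = (72 * (F.L : ℝ) ^ (3 * F.m)) * ((F.L : ℝ) ^ h) ^ 3 := by ring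
      _ ≤ (72 * (F.L : ℝ) ^ (3 * F.m)) * Real.exp (6 * P) := mul_le_mul_of_nonneg_left h3 (by positivity)
  -- (b2) the label count
  have hsPD : ((F.P K).sitesPerDir 0 : ℝ) = 2 * (F.L : ℝ) ^ F.m * (F.L : ℝ) ^ h * Lj := by
    have : (F.P K).sitesPerDir 0 = 2 * F.L ^ (F.m + K) := by
      simp [Params.sitesPerDir]
    rw [this, show F.m + K = F.m + h + j by omega, pow_add, pow_add]; push_cast; ring
  have b2 : J * ((⌊R * Lj⌋₊ : ℝ) + 1) ^ 2 * (((F.P K).sitesPerDir 0 : ℝ)) ^ 3 * 9 ≤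
      Real.exp (Real.log (288 * R ^ 2 * (F.L : ℝ) ^ (3 * F.m)) + (7 + 5 * ℓ) * P) := by
    have hfl : ((⌊R * Lj⌋₊ : ℝ) + 1) ≤ 2 * R * Lj := by
      have h1 : ((⌊R * Lj⌋₊ : ℝ)) ≤ R * Lj := Nat.floor_le (by positivity)
      have h2 : (1 : ℝ) ≤ R * Lj := one_le_mul_of_one_le_of_one_le (by linarith) hLj1
      linarith
    have hfl2 : ((⌊R * Lj⌋₊ : ℝ) + 1) ^ 2 ≤ 4 * R ^ 2 * Real.exp (2 * ℓ * P) := by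
      calc ((⌊R * Lj⌋₊ : ℝ) + 1) ^ 2 ≤ (2 * R * Lj) ^ 2 := pow_le_pow_left₀ (by positivity) hfl 2
        _ = 4 * R ^ 2 * Lj ^ 2 := by ring
        _ ≤ 4 * R ^ 2 * (Real.exp (ℓ * P)) ^ 2 := by gcongr
        _ = 4 * R ^ 2 * Real.exp (2 * ℓ * P) := by rw [← Real.exp_nat_mul]; ring_nf
    have hs3 : (((F.P K).sitesPerDir 0 : ℝ)) ^ 3 ≤ 8 * (F.L : ℝ) ^ (3 * F.m) * Real.exp ((6 + 3 * ℓ) * P) := by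
      rw [hsPD]
      calc (2 * (F.L : ℝ) ^ F.m * (F.L : ℝ) ^ h * Lj) ^ 3
          = 8 * ((F.L : ℝ) ^ F.m) ^ 3 * (((F.L : ℝ) ^ h) ^ 3 * Lj ^ 3) := by ring
        _ ≤ 8 * ((F.L : ℝ) ^ F.m) ^ 3 * ((Real.exp (2 * P)) ^ 3 * (Real.exp (ℓ * P)) ^ 3) := by gcongr
        _ = 8 * (F.L : ℝ) ^ (3 * F.m) * Real.exp ((6 + 3 * ℓ) * P) := by
            rw [← pow_mul, ← Real.exp_nat_mul, ← Real.exp_nat_mul, mul_comm F.m 3, mul_assoc, ← Real.exp_add]; ring_nf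
    rw [Real.exp_add, Real.exp_log (by positivity)]
    have hJ0 : 0 ≤ J := by linarith
    calc J * ((⌊R * Lj⌋₊ : ℝ) + 1) ^ 2 * (((F.P K).sitesPerDir 0 : ℝ)) ^ 3 * 9
        ≤ Real.exp P * (4 * R ^ 2 * Real.exp (2 * ℓ * P)) * (8 * (F.L : ℝ) ^ (3 * F.m) * Real.exp ((6 + 3 * ℓ) * P)) * 9 := by
          gcongr
      _ = (288 * R ^ 2 * (F.L : ℝ) ^ (3 * F.m)) * (Real.exp P * Real.exp (2 * ℓ * P) * Real.exp ((6 + 3 * ℓ) * P)) := by ring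
      _ = (288 * R ^ 2 * (F.L : ℝ) ^ (3 * F.m)) * Real.exp ((7 + 5 * ℓ) * P) := by
          rw [← Real.exp_add, ← Real.exp_add]; ring_nf
  -- (b3) the printed prefactor
  have b3 : CR * β ^ AR * (R * Lj) ^ AR ≤ Real.exp ((Real.log (CR + 1) + (AR : ℝ) * Real.log R) + (AR : ℝ) * (4 + 2 * ℓ) * P) := by
    have hC : CR ≤ Real.exp (Real.log (CR + 1)) := by rw [Real.exp_log (by linarith)]; linarith
    have hβA : β ^ AR ≤ Real.exp ((AR : ℝ) * ((4 + ℓ) * P)) := by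
      calc β ^ AR ≤ (Real.exp ((4 + ℓ) * P)) ^ AR := pow_le_pow_left₀ hβpos.le eβ AR
        _ = Real.exp ((AR : ℝ) * ((4 + ℓ) * P)) := by rw [← Real.exp_nat_mul]
    have hRL : (R * Lj) ^ AR ≤ Real.exp ((AR : ℝ) * (Real.log R + ℓ * P)) := by
      have h1 : R * Lj ≤ Real.exp (Real.log R + ℓ * P) := by
        rw [Real.exp_add, Real.exp_log hR0]; exact mul_le_mul_of_nonneg_left eLj hR0.le
      calc (R * Lj) ^ AR ≤ (Real.exp (Real.log R + ℓ * P)) ^ AR := pow_le_pow_left₀ (by positivity) h1 AR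
        _ = Real.exp ((AR : ℝ) * (Real.log R + ℓ * P)) := by rw [← Real.exp_nat_mul]
    have := mul_le_exp_add (mul_le_exp_add hC (pow_nonneg hβpos.le AR) hβA) (by positivity) hRL
    refine this.trans (Real.exp_le_exp.mpr (le_of_eq ?_)); ring
  -- (b4) the gain
  have hρ : P ^ (2 * N - 3) / c₁ ≤ (θ / (2 * D * J)) ^ 2 * β / (R * Lj * (1 + Real.log (R * Lj))) := by
    have hlogRL : Real.log (R * Lj) = Real.log R + (j : ℝ) * ℓ := by
      rw [Real.log_mul hR0.ne' hLj0.ne', hLj, Real.log_pow]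
    have hden0 : 0 < R * Lj * (1 + Real.log (R * Lj)) := by
      rw [hlogRL]; have : 0 ≤ (j : ℝ) * ℓ := by positivity
      positivity
    have hnum : (θ / (2 * D * J)) ^ 2 * β = p ^ 2 * Lj / (2 * D * J) ^ 2 := by
      rw [div_pow, div_mul_eq_mul_div, hθβ]
    rw [hnum, div_div, div_le_div_iff₀ hc₁0 (by positivity), hlogRL]
    -- `P^{2N-3} · ((2DJ)² · R Lj (1 + log R + jℓ)) ≤ p² Lj · c₁`
    have h2N : P ^ (2 * N - 3) * P ^ 3 = P ^ (2 * N) := by rw [← pow_add]; congr 1; omega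
    have hPN2 : P ^ (2 * N) ≤ p ^ 2 := by
      rw [pow_mul']; exact pow_le_pow_left₀ (pow_nonneg hP0.le N) hPN 2
    have hJ2 : J ^ 2 ≤ P ^ 2 := pow_le_pow_left₀ (by linarith) hJP 2
    have hlin : 1 + Real.log R + (j : ℝ) * ℓ ≤ (1 + Real.log R + ℓ) * P := by
      have h1 : 1 + Real.log R ≤ (1 + Real.log R) * P := le_mul_of_one_le_right (by positivity) hP1
      have h3 : (1 + Real.log R + ℓ) * P = (1 + Real.log R) * P + ℓ * P := by ring
      rw [h3]; linarith
    have hlin0 : 0 ≤ 1 + Real.log R + (j : ℝ) * ℓ := by positivity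
    calc P ^ (2 * N - 3) * ((2 * D * J) ^ 2 * (R * Lj * (1 + (Real.log R + (j : ℝ) * ℓ))))
        = (4 * D ^ 2 * R * Lj) * (P ^ (2 * N - 3) * (J ^ 2 * (1 + Real.log R + (j : ℝ) * ℓ))) := by ring
      _ ≤ (4 * D ^ 2 * R * Lj) * (P ^ (2 * N - 3) * (P ^ 2 * ((1 + Real.log R + ℓ) * P))) := by
          have : J ^ 2 * (1 + Real.log R + (j : ℝ) * ℓ) ≤ P ^ 2 * ((1 + Real.log R + ℓ) * P) :=
            mul_le_mul hJ2 hlin hlin0 (by positivity)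
          exact mul_le_mul_of_nonneg_left (mul_le_mul_of_nonneg_left this (by positivity)) (by positivity)
      _ = (4 * D ^ 2 * R * (1 + Real.log R + ℓ)) * Lj * (P ^ (2 * N - 3) * P ^ 3) := by ring
      _ = c₁ * Lj * P ^ (2 * N) := by rw [h2N]
      _ ≤ c₁ * Lj * p ^ 2 := mul_le_mul_of_nonneg_left hPN2 (by positivity)
      _ = p ^ 2 * Lj * c₁ := by ring
  have b4 : Real.exp (-((cR * ((θ / (2 * D * J)) ^ 2 * β / (R * Lj * (1 + Real.log (R * Lj))))) ^ αR)) ≤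
      Real.exp (-(κ * P ^ e)) := by
    refine Real.exp_le_exp.mpr (neg_le_neg ?_)
    have h0 : 0 ≤ cR * (P ^ (2 * N - 3) / c₁) := by positivity
    have h1 : cR * (P ^ (2 * N - 3) / c₁) ≤ cR * ((θ / (2 * D * J)) ^ 2 * β / (R * Lj * (1 + Real.log (R * Lj)))) :=
      mul_le_mul_of_nonneg_left hρ hcR.le
    have h2 : (cR * (P ^ (2 * N - 3) / c₁)) ^ αR = κ * P ^ e := by
      rw [show cR * (P ^ (2 * N - 3) / c₁) = (cR / c₁) * P ^ (2 * N - 3) by ring,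
        Real.mul_rpow (div_pos hcR hc₁0).le (pow_nonneg hP0.le _), hκ, he, ← Real.rpow_natCast P (2 * N - 3),
        ← Real.rpow_mul hP0.le]
    calc κ * P ^ e = (cR * (P ^ (2 * N - 3) / c₁)) ^ αR := h2.symm
      _ ≤ _ := Real.rpow_le_rpow h0 h1 hαR.le
  -- (b5) the geometric factor
  have b5 : Real.exp (-(2 * P)) ≤ ((1 : ℝ) / 2) ^ h := by
    rw [one_div, inv_pow, ← Real.exp_log (pow_pos two_pos h), ← Real.exp_neg, Real.log_pow]
    refine Real.exp_le_exp.mpr (neg_le_neg ?_)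
    calc (h : ℝ) * Real.log 2 ≤ (h : ℝ) * ℓ := mul_le_mul_of_nonneg_left hℓ2 (Nat.cast_nonneg h)
      _ ≤ 2 * P := hhℓ
  -- (b6) the bounded exponent
  have b6 : k * P - κ * P ^ e ≤ M := linear_sub_rpow_le hk0 hκ0 heR hP1
  -- assemble
  have hT : (9 * (8 * (F.L : ℝ) ^ (3 * F.m) * ((F.L : ℝ) ^ h) ^ 3)) *
      ((J * ((⌊R * Lj⌋₊ : ℝ) + 1) ^ 2 * (((F.P K).sitesPerDir 0 : ℝ)) ^ 3 * 9) *
        (CR * β ^ AR * (R * Lj) ^ AR *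
          Real.exp (-((cR * ((θ / (2 * D * J)) ^ 2 * β / (R * Lj * (1 + Real.log (R * Lj))))) ^ αR)))) ≤
      Real.exp ((Real.log (72 * (F.L : ℝ) ^ (3 * F.m)) + 6 * P) +
        ((Real.log (288 * R ^ 2 * (F.L : ℝ) ^ (3 * F.m)) + (7 + 5 * ℓ) * P) +
          (((Real.log (CR + 1) + (AR : ℝ) * Real.log R) + (AR : ℝ) * (4 + 2 * ℓ) * P) + -(κ * P ^ e)))) := by
    refine mul_le_exp_add b1 (by positivity) (mul_le_exp_add b2 (by positivity) (mul_le_exp_add b3 (by positivity) b4))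
  refine hT.trans ?_
  have hsum : (Real.log (72 * (F.L : ℝ) ^ (3 * F.m)) + 6 * P) +
        ((Real.log (288 * R ^ 2 * (F.L : ℝ) ^ (3 * F.m)) + (7 + 5 * ℓ) * P) +
          (((Real.log (CR + 1) + (AR : ℝ) * Real.log R) + (AR : ℝ) * (4 + 2 * ℓ) * P) + -(κ * P ^ e))) =
      Kc + (k * P - κ * P ^ e) + -(2 * P) := by
    rw [hKc, hk]; ring
  rw [hsum, Real.exp_add, Real.exp_add]
  calc Real.exp Kc * Real.exp (k * P - κ * P ^ e) * Real.exp (-(2 * P))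
      ≤ Real.exp Kc * Real.exp M * ((1 : ℝ) / 2) ^ h := by
        gcongr
    _ = Real.exp (Kc + M) * ((1 : ℝ) / 2) ^ h := by rw [← Real.exp_add]


end Summit.QuantumFields.YangMills.Theorems.RandomisedStokesOffSliverArith

end
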